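import Mathlib
import Literature.Probability.Percolation.DiagonalStripPairingPolynomial
import HarnessLib

/-!
# IP12 Proposition 4.5 in the `U`-world: the closed form `N̂ = κ² Ĉ` of the left-passage numerator

Topic `Literature/Probability/Percolation`. Ikhlef–Ponsaing (J. Stat. Phys. 149 (2012),
arXiv:1202.5476) Prop. 4.5: `Σ_a P_a(ζ_1; z_1..z_L) = Ψ*_{0;L-1}(z_1..z_{L-1}) Ψ*_{1;L+1}(z_1..z_L, ζ_1)`,
i.e. (Def. 4.1, `ζ_1 = z_L` for the first site) the numerator of the left-passage probability is
`χ_{L-1}(z_1², …, z_{L-1}²) · χ_{L+1}(z_1², …, z_L², z_L²)` up to the normalisation of the ground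
state. In the cluster language (`DiagonalStripPairingPolynomial`: `N̂ = nHat`, `Ẑ = zSumHat`,
`IsGroundState`, `GroundStateBounds`) this file proves

  **`IsGroundState.closedForm`**: at every width `n`, for the primitive exact ground state `P`,
  `Ẑ = κ χ̂_{2n+1}` and `N̂ = κ² Ĉ_n` with `Ĉ_n = (∏_{k ≤ 2n} U_k) χ̂_{2n}(U_1..U_{2n}) χ̂_{2n+2}(U_1..U_{2n+1}, U_{2n+1})`
  (`cHat`), `κ ∈ ℂˣ` — given the external `GroundStateBounds` at the widths `1, …, n`.

The proof is IP12's (§4.3): by induction on the width, both sides agree on `U_2 = ω U_1`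
(`nHat_recursion` = Prop. 4.3, the sum rule `Ẑ = κ χ̂` at both widths, the exact character recursion
`DiagonalStripCharacterRecursion`, and the closed form at the smaller width — `resEta_nHat`,
`resEta_cHat_succ`), both are symmetric in `U_1, …, U_{2n}` and palindromic of formal degree `4n` in
each of them (`rename_swap_nHat`, `pal_nHat` from the `σ_i`/`ι_j`-invariance of `N` over the rapidity
field; `rename_swap_cHat`, `pal_cHat`), and both are divisible by `∏_{k ≤ 2n} U_k` (`prod_X_dvd_nHat`,
from the vanishing hypothesis on junction pairs; `prod_X_dvd_cHat`); the quotient of the difference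
then has too many roots for its degree (`eq_zero_of_res_eq_zero'`). The width-`0` system is explicit
(`IsGroundState.width_zero`, `closedForm_zero`).

## References

* Y. Ikhlef, A. K. Ponsaing, *Finite-size left-passage probability in percolation*, J. Stat. Phys.
  149 (2012) 10–36, arXiv:1202.5476, Def. 4.1, Props. 4.1, 4.3, 4.5. [IkhlefPonsaing2012]
-/

namespace Literature.Probability.Percolation

open Finset Literature.Probability.LatticeModels Literature.Probability.LatticeModels.TemperleyLieb

/-! ### Invariances of the numerator over the rapidity field -/

section NInvariance

open MvPolynomial

variable {n : ℕ} {q : ℂ} {P : ColPattern n → MvPolynomial ℕ ℂ} {a : ℤ}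

namespace IsGroundState

/-- Components vanish off the physical sector. [folklore] -/
theorem supp (hq : q ^ 2 + q + 1 = 0) (h : IsGroundState n q P a) (Q : ColPattern n) (hQ : toRF ℂ (P Q) ≠ 0) :
    IsValid 0 Q ∧ IsPlanar Q ∧ lump Q = Q :=
  groundState_support hq h.fixed hQ

/-- **`σ_i N = N` for `1 ≤ i ≤ 2n - 1`** (all bulk levels except the top even one). [cite: IkhlefPonsaing2012, Prop. 4.1] -/
theorem genSwap_ipNpair (hq : q ^ 2 + q + 1 = 0) (h : IsGroundState n q P a) {i : ℕ} (hi : 1 ≤ i) (hi2 : i + 1 ≤ 2 * n) :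
    genSwap ℂ i (ipNpair fun Q => toRF ℂ (P Q)) = ipNpair fun Q => toRF ℂ (P Q) := by
  obtain ⟨k, hk | hk⟩ := Nat.even_or_odd' i
  · have hb : k - 1 < n := by omega
    have hb' : ((⟨k - 1, hb⟩ : Fin n) : ℕ) + 1 < n := by simp only; omega
    have := (genSwap_ipNpair_even hq (h.supp hq) ⟨k - 1, hb⟩ hb' (h.even ⟨k - 1, hb⟩)).1
    have hidx : 2 * ((⟨k - 1, hb⟩ : Fin n) : ℕ) + 2 = i := by simp only; omega
    rwa [hidx] at this
  · have hb : k < n := by omega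
    have := (genSwap_ipNpair_odd hq (h.supp hq) ⟨k, hb⟩ (h.odd ⟨k, hb⟩)).1
    have hidx : 2 * ((⟨k, hb⟩ : Fin n) : ℕ) + 1 = i := by simp only; omega
    rwa [hidx] at this

/-- **`ι_j N = N` for `1 ≤ j ≤ 2n`** (from `ι_1 N = N` and the swap symmetries) and for `j = 2n+1` (top).
[cite: IkhlefPonsaing2012, Prop. 4.1] -/
theorem genInv_ipNpair (hq : q ^ 2 + q + 1 = 0) (h : IsGroundState n q P a) :
    ∀ j, 1 ≤ j → j ≤ 2 * n + 1 → genInv ℂ j (ipNpair fun Q => toRF ℂ (P Q)) = ipNpair fun Q => toRF ℂ (P Q) := by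
  intro j hj hjL
  by_cases htop : j = 2 * n + 1
  · subst htop; exact (genInv_ipNpair_of_zpow (by omega) le_rfl h.top).1
  have hjn : j ≤ 2 * n := by omega
  clear hjL htop
  induction j with
  | zero => omega
  | succ j ih =>
    rcases Nat.eq_zero_or_pos j with rfl | hj0
    · exact (genInv_ipNpair_of_zpow le_rfl (by omega) h.bot).1
    · exact genInv_succ_of_invariant (h.genSwap_ipNpair hq hj0 (by omega)) (ih hj0 (by omega))

end IsGroundState

end NInvariance

/-! ### Symmetry, degrees and palindromicity of `N̂` -/

section NHatProps

open MvPolynomial Literature.Combinatorics.Enumerative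

variable {n : ℕ} {q : ℂ} {P : ColPattern (n + 1) → MvPolynomial ℕ ℂ} {a : ℤ}

/-- The symmetric monomial is swap-invariant. [folklore] -/
theorem rename_swap_prod_X_pow {S : Finset ℕ} {i j : ℕ} (hi : i ∈ S) (hj : j ∈ S) (N : ℕ) :
    rename (Equiv.swap i j) (∏ k ∈ S, (X k : MvPolynomial ℕ ℂ) ^ N) = ∏ k ∈ S, X k ^ N := by
  rw [map_prod]
  simp only [map_pow, rename_X]
  exact Finset.prod_equiv (Equiv.swap i j) (fun k => by
    simp only [Equiv.swap_apply_def]; split_ifs <;> simp_all) (fun k _ => rfl)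

/-- `genSq ∘ toRF` is injective. [folklore] -/
theorem genSq_toRF_injective : Function.Injective fun F : MvPolynomial ℕ ℂ => genSq ℂ (toRF ℂ F) :=
  fun _ _ h => toRF_injective (genSq_injective h)

namespace IsGroundState

/-- **`N̂` is symmetric under the adjacent transpositions `σ_i`, `1 ≤ i ≤ 2n+1`.** [cite: IkhlefPonsaing2012, Prop. 4.1] -/
theorem rename_swap_nHat (hq : q ^ 2 + q + 1 = 0) (h : IsGroundState (n + 1) q P a) (hb : GroundStateBounds (n + 1) P)
    {i : ℕ} (hi : 1 ≤ i) (hi2 : i + 1 ≤ 2 * (n + 1)) :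
    rename (Equiv.swap i (i + 1)) (nHat (n + 1) P) = nHat (n + 1) P := by
  have heven : ∀ Q, ∀ s ∈ (P Q).support, ∀ k, Even (s k) := fun Q s hs k => h.even_exponent hq Q hs k
  have hdeg : ∀ k, 1 ≤ k → k ≤ 2 * (n + 1) + 1 → ∀ Q, (uHalf ℂ (P Q)).degreeOf k ≤ 2 * (n + 1) :=
    fun k hk hkL Q => h.degreeOf_uHalf_le' hq hb hk hkL Q
  apply genSq_toRF_injective
  simp only
  rw [← genSwap_toRF, genSq_genSwap, genSq_toRF_nHat heven hdeg, map_mul, h.genSwap_ipNpair hq hi hi2,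
    show (∏ k ∈ Finset.Icc 1 (2 * (n + 1) + 1), genZ ℂ k ^ (4 * (n + 1))) =
      toRF ℂ (∏ k ∈ Finset.Icc 1 (2 * (n + 1) + 1), X k ^ (4 * (n + 1))) by
        rw [map_prod]; simp only [map_pow]; rfl,
    genSwap_toRF, rename_swap_prod_X_pow (by simp; omega) (by simp; omega)]

/-- Hence under every transposition of `{1, …, 2n+2}`. [folklore] -/
theorem rename_swap_nHat' (hq : q ^ 2 + q + 1 = 0) (h : IsGroundState (n + 1) q P a) (hb : GroundStateBounds (n + 1) P)
    {i j : ℕ} (hi : 1 ≤ i) (hij : i ≤ j) (hj : j ≤ 2 * (n + 1)) :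
    rename (Equiv.swap i j) (nHat (n + 1) P) = nHat (n + 1) P :=
  rename_swap_eq_of_adjacent j hij fun k hk hkj => h.rename_swap_nHat hq hb (by omega) (by omega)

/-- **Window degrees of `N̂` are `≤ 4m`.** [folklore] -/
theorem degreeOf_nHat_le (hq : q ^ 2 + q + 1 = 0) (h : IsGroundState (n + 1) q P a) (hb : GroundStateBounds (n + 1) P)
    {k : ℕ} (hk : 1 ≤ k) (hkL : k ≤ 2 * (n + 1) + 1) : (nHat (n + 1) P).degreeOf k ≤ 4 * (n + 1) := by
  classical
  have hdeg : ∀ Q, (uHalf ℂ (P Q)).degreeOf k ≤ 2 * (n + 1) := fun Q => h.degreeOf_uHalf_le' hq hb hk hkL Q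
  have hrev : ∀ Q, (revAll ℂ (2 * (n + 1)) (2 * (n + 1) + 1) (uHalf ℂ (P Q))).degreeOf k ≤ 2 * (n + 1) := by
    intro Q
    -- peel the reversals above `k`, then the one at `k`
    suffices hmain : ∀ L, k ≤ L → (revAll ℂ (2 * (n + 1)) L (uHalf ℂ (P Q))).degreeOf k ≤ 2 * (n + 1) from
      hmain _ hkL
    intro L hL
    induction L with
    | zero => omega
    | succ L ih =>
      rw [revAll]
      by_cases hkL' : k = L + 1
      · subst hkL'; exact degreeOf_revPoly_le _ _ _
      · exact (degreeOf_revPoly_of_ne hkL' _).trans (by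
          rcases Nat.lt_or_ge L k with h1 | h1
          · exact (degreeOf_revAll_le (Or.inl h1) _).trans (hdeg Q)
          · exact ih h1)
  rw [nHat]
  refine (degreeOf_sum_le _ _ _).trans (Finset.sup_le fun Q _ => (degreeOf_sum_le _ _ _).trans (Finset.sup_le fun Q' _ => ?_))
  refine (degreeOf_mul_le _ _ _).trans ?_
  have hJ : (if ipJunction (n + 1) (Fin.last (n + 1)) Q Q' = true then (1 : MvPolynomial ℕ ℂ) else 0).degreeOf k = 0 := by
    split_ifs
    · rw [degreeOf_one]
    · rw [degreeOf_zero]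
  rw [hJ, add_zero]
  refine (degreeOf_mul_le _ _ _).trans ?_
  have := hrev Q; have := hdeg Q'; omega

/-- **`N̂` is palindromic in every window variable with formal degree `4m`** (field form).
[cite: IkhlefPonsaing2012, Prop. 4.1] -/
theorem pal_nHat (hq : q ^ 2 + q + 1 = 0) (h : IsGroundState (n + 1) q P a) (hb : GroundStateBounds (n + 1) P)
    {j : ℕ} (hj : 1 ≤ j) (hjL : j ≤ 2 * (n + 1) + 1) :
    genInv ℂ j (toRF ℂ (nHat (n + 1) P)) * genZ ℂ j ^ (4 * (n + 1)) = toRF ℂ (nHat (n + 1) P) := by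
  have heven : ∀ Q, ∀ s ∈ (P Q).support, ∀ k, Even (s k) := fun Q s hs k => h.even_exponent hq Q hs k
  have hdeg : ∀ k, 1 ≤ k → k ≤ 2 * (n + 1) + 1 → ∀ Q, (uHalf ℂ (P Q)).degreeOf k ≤ 2 * (n + 1) :=
    fun k hk hkL Q => h.degreeOf_uHalf_le' hq hb hk hkL Q
  have hz : genZ ℂ j ≠ 0 := genZ_ne_zero j
  apply genSq_injective (K₀ := ℂ)
  rw [map_mul, genSq_genInv, map_pow, genSq_genZ, genSq_toRF_nHat heven hdeg, map_mul, h.genInv_ipNpair hq j hj hjL,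
    map_prod]
  simp only [map_pow, genInv_genZ]
  rw [← Finset.mul_prod_erase _ _ (Finset.mem_Icc.2 ⟨hj, hjL⟩), Function.update_self,
    Finset.prod_congr rfl fun k hk => by rw [Function.update_of_ne (Finset.ne_of_mem_erase hk)],
    ← Finset.mul_prod_erase (Finset.Icc 1 (2 * (n + 1) + 1)) (fun k => genZ ℂ k ^ (4 * (n + 1))) (Finset.mem_Icc.2 ⟨hj, hjL⟩)]
  rw [inv_pow, ← pow_mul]
  field_simp
  ring

end IsGroundState

end NHatProps

/-! ### Divisibility of `N̂` by the window variables -/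

section NHatDvd

open MvPolynomial Literature.Combinatorics.Enumerative

/-- Reversal through finite sums. [folklore] -/
theorem revPoly_finset_sum {K₀ : Type*} [Field K₀] {ι : Type*} (k N : ℕ) (S : Finset ι) (f : ι → MvPolynomial ℕ K₀) :
    revPoly k N (∑ i ∈ S, f i) = ∑ i ∈ S, revPoly k N (f i) := by
  classical
  induction S using Finset.induction_on with
  | empty => rw [Finset.sum_empty, Finset.sum_empty, revPoly_zero]
  | insert a S ha ih => rw [Finset.sum_insert ha, Finset.sum_insert ha, revPoly_add, ih]

/-- The reversed exponent of a shift in another variable. [folklore] -/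
theorem revExp_add_single_of_ne {k j N : ℕ} (hjk : j ≠ k) (e : ℕ →₀ ℕ) :
    revExp k N (e + Finsupp.single j 1) = revExp k N e + Finsupp.single j 1 := by
  ext i
  by_cases hi : i = k
  · subst hi
    rw [revExp_apply_self, Finsupp.add_apply, Finsupp.add_apply, revExp_apply_self, Finsupp.single_apply, if_neg hjk]
    rfl
  · rw [revExp_apply_of_ne _ hi, Finsupp.add_apply, Finsupp.add_apply, revExp_apply_of_ne _ hi]

/-- Reversal at `k` through a factor `X_j`, `j ≠ k`. [folklore] -/
theorem revPoly_X_mul_of_ne {k j N : ℕ} (hjk : j ≠ k) (G : MvPolynomial ℕ ℂ) :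
    revPoly k N (X j * G) = X j * revPoly k N G := by
  classical
  conv_lhs => rw [G.as_sum, Finset.mul_sum, revPoly_finset_sum]
  rw [revPoly, Finset.mul_sum]
  refine Finset.sum_congr rfl fun e _ => ?_
  rw [X, monomial_mul, one_mul, revPoly_monomial, add_comm, revExp_add_single_of_ne hjk, monomial_mul, one_mul, add_comm]

/-- `X_1`-divisibility passes through the full reversal (the reversal at `1` having been done). [folklore] -/
theorem dvd_revAll_of_dvd {N : ℕ} {F : MvPolynomial ℕ ℂ} (h : X 1 ∣ revPoly 1 N F) :
    ∀ {L : ℕ}, 1 ≤ L → X 1 ∣ revAll ℂ N L F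
  | 0, hL => absurd hL (by omega)
  | L + 1, _ => by
    rcases Nat.eq_zero_or_pos L with rfl | hL0
    · exact h
    · obtain ⟨G, hG⟩ := dvd_revAll_of_dvd h hL0
      rw [revAll, hG, revPoly_X_mul_of_ne (by omega)]
      exact dvd_mul_right _ _

/-- Setting `X_1 = 0` commutes with squaring the variables. [folklore] -/
theorem substHom_zero_uSq (F : MvPolynomial ℕ ℂ) : substHom 1 0 (uSq ℂ F) = uSq ℂ (substHom 1 0 F) := by
  have : (substHom 1 (0 : MvPolynomial ℕ ℂ)).comp (uSq ℂ) = (uSq ℂ).comp (substHom 1 0) := by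
    refine algHom_ext fun k => ?_
    by_cases hk : k = 1
    · subst hk; simp [uSq_X]
    · simp [uSq_X, substHom_X_of_ne _ hk]
  exact AlgHom.congr_fun this F

/-- A product of distinct variables divides a polynomial divisible by each of them. [folklore] -/
theorem finset_prod_X_dvd {S : Finset ℕ} {F : MvPolynomial ℕ ℂ} (h : ∀ j ∈ S, X j ∣ F) : ∏ j ∈ S, X j ∣ F := by
  classical
  induction S using Finset.induction_on generalizing F with
  | empty => rw [Finset.prod_empty]; exact one_dvd _
  | insert a S ha ih =>
    obtain ⟨G, hG⟩ := ih fun j hj => h j (Finset.mem_insert_of_mem hj)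
    have haF := h a (Finset.mem_insert_self a S)
    rw [hG, X_dvd_mul_iff] at haF
    rcases haF with h1 | h1
    · exfalso
      obtain ⟨k, hk, hak⟩ := (X_prime (i := a)).dvd_finsetProd_iff _ |>.1 h1
      rw [X_dvd_X] at hak
      exact ha (hak ▸ hk)
    · obtain ⟨G', rfl⟩ := h1
      rw [Finset.prod_insert ha, hG]
      exact ⟨G', by ring⟩

variable {n : ℕ} {q : ℂ} {P : ColPattern (n + 1) → MvPolynomial ℕ ℂ} {a : ℤ}

namespace IsGroundState

/-- **The `U`-world components are palindromic in `U_1` with formal degree `2m`.** [folklore] -/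
theorem revPoly_one_uHalf (hq : q ^ 2 + q + 1 = 0) (h : IsGroundState (n + 1) q P a) (hb : GroundStateBounds (n + 1) P)
    (Q : ColPattern (n + 1)) : revPoly 1 (2 * (n + 1)) (uHalf ℂ (P Q)) = uHalf ℂ (P Q) := by
  obtain ⟨ha, -⟩ := h.sumRule hq hb
  refine revPoly_eq_self_of_genInv (h.degreeOf_uHalf_le' hq hb le_rfl (by omega) Q) ?_
  apply genSq_injective (K₀ := ℂ)
  have hz : genZ ℂ 1 ≠ 0 := genZ_ne_zero 1
  rw [map_mul, genSq_genInv, map_pow, genSq_genZ, genSq_toRF, h.uSq_uHalf_eq hq, h.bot Q, ha, ← pow_mul, mul_assoc,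
    mul_comm (toRF ℂ (P Q)), ← mul_assoc, ← zpow_natCast, ← zpow_add₀ hz]
  have : (2 * -(2 * (n : ℤ) + 2) + ((2 * (2 * (n + 1)) : ℕ) : ℤ)) = 0 := by push_cast; ring
  rw [this, zpow_zero, one_mul]

/-- **`X_1` divides `N̂`** (from the vanishing hypothesis on junction pairs). [cite: IkhlefPonsaing2012, Prop. 4.5 (proof)] -/
theorem X_one_dvd_nHat (hq : q ^ 2 + q + 1 = 0) (h : IsGroundState (n + 1) q P a) (hb : GroundStateBounds (n + 1) P) :
    X 1 ∣ nHat (n + 1) P := by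
  rw [nHat]
  refine Finset.dvd_sum fun Q _ => Finset.dvd_sum fun Q' _ => ?_
  by_cases hJ : ipJunction (n + 1) (Fin.last (n + 1)) Q Q' = true
  · rw [if_pos hJ, mul_one]
    have hvan := hb.vanish Q Q' hJ
    have hzero : ∀ R, substHom 1 0 (P R) = 0 → X 1 ∣ uHalf ℂ (P R) := fun R hR => by
      have h1 : substHom 1 0 (uHalf ℂ (P R)) = 0 := by
        apply uSq_injective (K₀ := ℂ)
        rw [← substHom_zero_uSq, h.uSq_uHalf_eq hq, hR, map_zero]
      simpa using X_sub_dvd_of_substHom_eq_zero h1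
    rcases mul_eq_zero.1 hvan with h0 | h0
    · refine dvd_mul_of_dvd_left (dvd_revAll_of_dvd ?_ (by omega)) _
      rw [h.revPoly_one_uHalf hq hb Q]
      exact hzero Q h0
    · exact dvd_mul_of_dvd_right (hzero Q' h0) _
  · rw [if_neg hJ, mul_zero]; exact dvd_zero _

/-- **Every `X_j`, `1 ≤ j ≤ 2m`, divides `N̂`** (symmetry). [folklore] -/
theorem X_dvd_nHat (hq : q ^ 2 + q + 1 = 0) (h : IsGroundState (n + 1) q P a) (hb : GroundStateBounds (n + 1) P)
    {j : ℕ} (hj : 1 ≤ j) (hjL : j ≤ 2 * (n + 1)) : X j ∣ nHat (n + 1) P := by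
  have h1 := map_dvd (rename (Equiv.swap 1 j)) (h.X_one_dvd_nHat hq hb)
  rwa [rename_X, Equiv.swap_apply_left, h.rename_swap_nHat' hq hb le_rfl hj hjL] at h1

/-- **`∏_{j ≤ 2m} X_j` divides `N̂`.** [folklore] -/
theorem prod_X_dvd_nHat (hq : q ^ 2 + q + 1 = 0) (h : IsGroundState (n + 1) q P a) (hb : GroundStateBounds (n + 1) P) :
    ∏ j ∈ Finset.Icc 1 (2 * (n + 1)), X j ∣ nHat (n + 1) P :=
  finset_prod_X_dvd fun _ hj => h.X_dvd_nHat hq hb (Finset.mem_Icc.1 hj).1 (Finset.mem_Icc.1 hj).2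

end IsGroundState

end NHatDvd

/-! ### Character-side bookkeeping: small windows, shifts, doubling, `Ĉ` -/

section CharSide

open MvPolynomial Literature.Combinatorics.Enumerative

variable {K₀ : Type*} [Field K₀]

/-- `χ̂_L` for `L ≤ 2` is the constant `1` (`ipSpDim 0 = ipSpDim 1 = ipSpDim 2 = 1`). [folklore] -/
theorem uChar_of_le_two [CharZero K₀] [Algebra ℝ K₀] (u : ℕ) {L : ℕ} (hL : L ≤ 2) : uChar K₀ u L = 1 := by
  have hdeg : ∀ n, (uChar K₀ u L).degreeOf n = 0 := fun n => by
    have := degreeOf_uChar_le (K₀ := K₀) u L n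
    have h0 : 2 * ((L - 1) / 2) = 0 := by omega
    rw [h0] at this
    split_ifs at this <;> omega
  have hC := eq_C_of_forall_degreeOf_eq_zero hdeg
  have hev := eval_one_uChar (K₀ := K₀) u L
  rw [hC, eval_C] at hev
  have hdim : ipSpDim L = 1 := by
    interval_cases L <;> norm_num [ipSpDim, ipSpStep, ipMu, Finset.prod_range_succ]
  rw [hC, hev, hdim]
  simp

/-- A renaming that shifts the window maps the alternant to the shifted alternant. [folklore] -/
theorem rename_xAlt_of_shift {ρ : ℕ → ℕ} {u u' L : ℕ} (hρ : ∀ i, i < L → ρ (u + i) = u' + i) (e : ℕ → ℕ) :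
    rename ρ (xAlt K₀ u L e) = xAlt K₀ u' L e := by
  rw [algHom_xAlt, xAlt]
  congr 1
  ext i k
  simp only [Matrix.of_apply, xAltMat, rename_X, hρ i i.2, xE]

/-- Hence `S_L` is mapped to the shifted `S_L`. [folklore] -/
theorem rename_spS_of_shift {ρ : ℕ → ℕ} {u u' L : ℕ} (hρ : ∀ i, i < L → ρ (u + i) = u' + i) :
    rename ρ (spS K₀ u L) = spS K₀ u' L := by
  apply eq_spS_of_mul_eq
  have h := congrArg (rename ρ) (xAlt_ipMu_eq (K := K₀) u L)
  rw [map_mul, rename_xAlt_of_shift hρ, rename_xAlt_of_shift hρ] at h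
  exact h

/-- And the transfer is mapped to the shifted transfer (for an injective renaming). [folklore] -/
theorem rename_uTransfer_of_shift {ρ : ℕ → ℕ} (hinj : Function.Injective ρ) {u u' L : ℕ}
    (hρ : ∀ i, i < L → ρ (u + i) = u' + i) (a : ℕ) (p : MvPolynomial ℕ K₀) :
    rename ρ (uTransfer K₀ u L a p) = uTransfer K₀ u' L a (rename ρ p) := by
  classical
  rw [uTransfer, uTransfer, map_sum, support_rename_of_injective hinj, Finset.sum_image fun s _ t _ h =>
    Finsupp.mapDomain_injective hinj h]
  refine Finset.sum_congr rfl fun s _ => ?_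
  rw [map_mul, rename_C, coeff_rename_mapDomain _ hinj, map_prod]
  congr 1
  -- reindex the window `u + i ↦ u' + i`
  refine Finset.prod_bij' (fun n _ => n - u + u') (fun n _ => n - u' + u) (fun n hn => ?_) (fun n hn => ?_)
    (fun n hn => ?_) (fun n hn => ?_) (fun n hn => ?_)
  · simp only [Finset.mem_Ico] at hn ⊢; omega
  · simp only [Finset.mem_Ico] at hn ⊢; omega
  · simp only [Finset.mem_Ico] at hn; omega
  · simp only [Finset.mem_Ico] at hn; omega
  · simp only [Finset.mem_Ico] at hn
    have hn' : ρ n = n - u + u' := by have := hρ (n - u) (by omega); rw [Nat.add_sub_cancel' hn.1] at this; omega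
    simp only [map_mul, map_pow, map_add, map_one, rename_X, hn']
    rw [← hn', Finsupp.mapDomain_apply hinj]

/-- **`χ̂_L` under a window shift**, e.g. `hatRename 1 (χ̂_L(U_1, …)) = χ̂_L(U_3, …)`. [folklore] -/
theorem rename_uChar_of_shift {ρ : ℕ → ℕ} (hinj : Function.Injective ρ) {u u' L : ℕ}
    (hρ : ∀ i, i < L → ρ (u + i) = u' + i) : rename ρ (uChar K₀ u L) = uChar K₀ u' L := by
  rw [uChar, rename_uTransfer_of_shift hinj hρ, rename_spS_of_shift hρ, uChar]

/-- The shift `ẑ` as a renaming. [folklore] -/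
theorem hatRename_eq_rename (i : ℕ) (F : MvPolynomial ℕ K₀) :
    hatRename i F = rename (fun k => if k < i then k else k + 2) F := rfl

/-- `ẑ (χ̂_L(U_1, …)) = χ̂_L(U_3, …)`. [folklore] -/
theorem hatRename_uChar (L : ℕ) : hatRename 1 (uChar K₀ 1 L) = uChar K₀ 3 L := by
  rw [hatRename_eq_rename]
  exact rename_uChar_of_shift (fun a b h => by split_ifs at h <;> omega) fun i _ => by
    show (if 1 + i < 1 then 1 + i else 1 + i + 2) = 3 + i
    rw [if_neg (by omega)]; ring

/-- **The doubling map** `X_{k+1} ↦ X_k` (identifying the last two variables). [folklore] -/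
def dblMap (k : ℕ) : ℕ → ℕ := fun i => if i = k + 1 then k else i

/-- `dblMap k` fixes every `i ≠ k+1`. [folklore] -/
theorem dblMap_of_ne {k i : ℕ} (h : i ≠ k + 1) : dblMap k i = i := if_neg h

/-- `dblMap k (k+1) = k`. [folklore] -/
theorem dblMap_succ (k : ℕ) : dblMap k (k + 1) = k := if_pos rfl

/-- `ẑ ∘ dbl_k = dbl_{k+2} ∘ ẑ` for `k ≥ 1`. [folklore] -/
theorem hatRename_rename_dblMap {k : ℕ} (hk : 1 ≤ k) (F : MvPolynomial ℕ K₀) :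
    hatRename 1 (rename (dblMap k) F) = rename (dblMap (k + 2)) (hatRename 1 F) := by
  rw [hatRename_eq_rename, hatRename_eq_rename, rename_rename, rename_rename]
  have : ((fun k => if k < 1 then k else k + 2) ∘ dblMap k) = (dblMap (k + 2) ∘ fun k => if k < 1 then k else k + 2) := by
    funext i
    simp only [Function.comp, dblMap]
    split_ifs <;> omega
  rw [this]

/-- `resEta` commutes with the doubling of far-away variables. [folklore] -/
theorem resEta_rename_dblMap (ω : K₀) {u k : ℕ} (hk : u + 2 ≤ k) (F : MvPolynomial ℕ K₀) :
    resEta K₀ ω u (rename (dblMap k) F) = rename (dblMap k) (resEta K₀ ω u F) := by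
  have : (resEta K₀ ω u).comp (rename (dblMap k)) = (rename (dblMap k)).comp (resEta K₀ ω u) := by
    refine algHom_ext fun i => ?_
    simp only [AlgHom.comp_apply, rename_X, resEta_X]
    by_cases hi : i = k + 1
    · subst hi; rw [dblMap_succ, if_neg (by omega), if_neg (by omega), rename_X, dblMap_succ]
    · rw [dblMap_of_ne hi]
      by_cases hi1 : i = u + 1
      · subst hi1; rw [if_pos rfl, map_mul, rename_C, rename_X, dblMap_of_ne (by omega)]
      · rw [if_neg hi1, rename_X, dblMap_of_ne hi]
  exact AlgHom.congr_fun this F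

/-- Transpositions away from the doubled pair commute with the doubling. [folklore] -/
theorem rename_swap_rename_dblMap {k a b : ℕ} (ha : a ≠ k) (ha' : a ≠ k + 1) (hb : b ≠ k) (hb' : b ≠ k + 1)
    (F : MvPolynomial ℕ K₀) :
    rename (Equiv.swap a b) (rename (dblMap k) F) = rename (dblMap k) (rename (Equiv.swap a b) F) := by
  rw [rename_rename, rename_rename]
  have : (⇑(Equiv.swap a b) ∘ dblMap k) = (dblMap k ∘ ⇑(Equiv.swap a b)) := by
    funext i
    simp only [Function.comp, dblMap, Equiv.swap_apply_def]
    split_ifs <;> omega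
  rw [this]

/-- **Doubling the last variable of `wheelE`**: `dbl (E_{L+1}) = E_L · wheelFac(u, u+1+L)`. [folklore] -/
theorem rename_dblMap_wheelE (ω : K₀) (u L : ℕ) :
    rename (dblMap (u + 1 + L)) (wheelE K₀ ω u (L + 1)) = wheelE K₀ ω u L * wheelFac K₀ ω u (u + 1 + L) := by
  rw [wheelE, show u + 2 + (L + 1) = (u + 2 + L) + 1 by ring, Finset.prod_Ico_succ_top (by omega), map_mul, map_prod,
    wheelE]
  congr 1
  · refine Finset.prod_congr rfl fun ℓ hℓ => ?_
    have hℓ' := Finset.mem_Ico.1 hℓ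
    unfold wheelFac
    simp only [map_mul, map_sub, rename_X, rename_C, dblMap_of_ne (show ℓ ≠ u + 1 + L + 1 by omega),
      dblMap_of_ne (show u ≠ u + 1 + L + 1 by omega)]
  · unfold wheelFac
    simp only [map_mul, map_sub, rename_X, rename_C, show u + 2 + L = (u + 1 + L) + 1 by ring, dblMap_succ,
      dblMap_of_ne (show u ≠ u + 1 + L + 1 by omega)]

/-- `E_{L+1} = E_L · wheelFac(u, u+2+L)`. [folklore] -/
theorem wheelE_succ (ω : K₀) (u L : ℕ) : wheelE K₀ ω u (L + 1) = wheelE K₀ ω u L * wheelFac K₀ ω u (u + 2 + L) := by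
  rw [wheelE, show u + 2 + (L + 1) = (u + 2 + L) + 1 by ring, Finset.prod_Ico_succ_top (by omega), wheelE]

/-- **`Ĉ_n`: the polynomial `U`-form of `χ_{L-1}(z_1..z_{L-1}) χ_{L+1}(z_1..z_L, z_L)`** at width `n`
(`L = 2n+1`): `(∏_{k ≤ 2n} U_k) · χ̂_{2n}(U_1..U_{2n}) · χ̂_{2n+2}(U_1, …, U_{2n+1}, U_{2n+1})`.
[cite: IkhlefPonsaing2012, Prop. 4.5] -/
noncomputable def cHat (K₀ : Type*) [Field K₀] (n : ℕ) : MvPolynomial ℕ K₀ :=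
  (∏ k ∈ Finset.Icc 1 (2 * n), X k) * uChar K₀ 1 (2 * n) * rename (dblMap (2 * n + 1)) (uChar K₀ 1 (2 * n + 2))

/-- `ẑ Ĉ_n`. [folklore] -/
theorem hatRename_cHat (n : ℕ) : hatRename 1 (cHat K₀ n) =
    (∏ k ∈ Finset.Icc 3 (2 * n + 2), X k) * uChar K₀ 3 (2 * n) * rename (dblMap (2 * n + 3)) (uChar K₀ 3 (2 * n + 2)) := by
  rw [cHat, map_mul, map_mul, hatRename_uChar, hatRename_rename_dblMap (by omega), hatRename_uChar, map_prod]
  congr 2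
  refine Finset.prod_bij' (fun k _ => k + 2) (fun k _ => k - 2) (fun k hk => ?_) (fun k hk => ?_) (fun k hk => ?_)
    (fun k hk => ?_) (fun k hk => ?_)
  · simp only [Finset.mem_Icc] at hk ⊢; omega
  · simp only [Finset.mem_Icc] at hk ⊢; omega
  · simp only [Finset.mem_Icc] at hk; omega
  · simp only [Finset.mem_Icc] at hk; omega
  · simp only [Finset.mem_Icc] at hk
    rw [hatRename_X, if_neg (by omega)]

/-- `χ̂_{2n+2}|_{U_{u+1} = ωU_u}` for every `n` (the case `n = 0` being trivial). [cite: IkhlefPonsaing2012, (26)–(27)] -/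
theorem resEta_uChar_even' [CharZero K₀] [Algebra ℝ K₀] {ω : K₀} (hω : ω ^ 2 + ω + 1 = 0) (hω1 : ω ≠ 1) (u n : ℕ) :
    resEta K₀ ω u (uChar K₀ u (2 * n + 2)) = C (ω ^ (2 * n)) * uChar K₀ (u + 2) (2 * n) * wheelE K₀ ω u (2 * n) := by
  rcases Nat.eq_zero_or_pos n with rfl | hn
  · rw [uChar_of_le_two u (by norm_num), uChar_of_le_two (u + 2) (by norm_num), wheelE, show u + 2 + 2 * 0 = u + 2 by ring,
      Finset.Ico_self, Finset.prod_empty, pow_zero, C_1, map_one, one_mul, one_mul]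
  · obtain ⟨m, rfl⟩ : ∃ m, n = m + 1 := ⟨n - 1, by omega⟩
    rw [show 2 * (m + 1) + 2 = 2 * m + 4 by ring, resEta_uChar_even hω hω1, show 2 * (m + 1) = 2 * m + 2 by ring]

/-- **`Ĉ_{n+1}|_{U_2 = ωU_1} = ω^{4n} · U_1² · E_{2n+1}² · ẑ Ĉ_n`.** [cite: IkhlefPonsaing2012, Prop. 4.5 (proof)] -/
theorem resEta_cHat_succ [CharZero K₀] [Algebra ℝ K₀] {ω : K₀} (hω : ω ^ 2 + ω + 1 = 0) (hω1 : ω ≠ 1) (n : ℕ) :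
    resEta K₀ ω 1 (cHat K₀ (n + 1)) =
      C (ω ^ (4 * n)) * X 1 ^ 2 * wheelE K₀ ω 1 (2 * n + 1) ^ 2 * hatRename 1 (cHat K₀ n) := by
  have hω3 : ω ^ 3 = 1 := IsWheelPoly.cube_eq_one hω
  -- the three factors
  have h1 : resEta K₀ ω 1 (∏ k ∈ Finset.Icc 1 (2 * (n + 1)), (X k : MvPolynomial ℕ K₀)) =
      C ω * X 1 ^ 2 * ∏ k ∈ Finset.Icc 3 (2 * n + 2), X k := by
    rw [show Finset.Icc 1 (2 * (n + 1)) = insert 1 (insert 2 (Finset.Icc 3 (2 * n + 2))) by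
      ext k; simp only [Finset.mem_Icc, Finset.mem_insert]; omega,
      Finset.prod_insert (by simp), Finset.prod_insert (by simp), map_mul, map_mul, resEta_X, if_neg (by norm_num),
      resEta_X, if_pos rfl, map_prod, Finset.prod_congr rfl fun k hk => by
        rw [resEta_X, if_neg (by simp only [Finset.mem_Icc] at hk; omega)]]
    ring
  have h2 := resEta_uChar_even' (K₀ := K₀) hω hω1 1 n
  have h3 : resEta K₀ ω 1 (rename (dblMap (2 * (n + 1) + 1)) (uChar K₀ 1 (2 * (n + 1) + 2))) =
      C (ω ^ (2 * n + 2)) * rename (dblMap (2 * n + 3)) (uChar K₀ 3 (2 * n + 2)) *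
        (wheelE K₀ ω 1 (2 * n + 1) * wheelFac K₀ ω 1 (2 * n + 3)) := by
    rw [show 2 * (n + 1) + 1 = 2 * n + 3 by ring, show 2 * (n + 1) + 2 = 2 * n + 4 by ring,
      resEta_rename_dblMap ω (by omega), resEta_uChar_even hω hω1, map_mul, map_mul, rename_C,
      show 2 * n + 3 = 1 + 1 + (2 * n + 1) by ring, show 2 * n + 2 = (2 * n + 1) + 1 by ring, rename_dblMap_wheelE]
  rw [cHat, map_mul, map_mul, h1, h3, show 2 * (n + 1) = 2 * n + 2 by ring, h2, hatRename_cHat, show 1 + 2 = 3 by rfl,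
    wheelE_succ ω 1 (2 * n), show 1 + 2 + 2 * n = 2 * n + 3 by ring]
  have hc : ω * ω ^ (2 * n) * ω ^ (2 * n + 2) = ω ^ (4 * n) := by
    calc ω * ω ^ (2 * n) * ω ^ (2 * n + 2) = ω ^ (4 * n) * ω ^ 3 := by ring
      _ = ω ^ (4 * n) := by rw [hω3, mul_one]
  have hc' : (C ω * C (ω ^ (2 * n)) * C (ω ^ (2 * n + 2)) : MvPolynomial ℕ K₀) = C (ω ^ (4 * n)) := by
    rw [← C_mul, ← C_mul, hc]
  linear_combination (X 1 ^ 2 * (∏ k ∈ Finset.Icc 3 (2 * n + 2), (X k : MvPolynomial ℕ K₀)) * uChar K₀ 3 (2 * n) *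
    rename (dblMap (2 * n + 3)) (uChar K₀ 3 (2 * n + 2)) * (wheelE K₀ ω 1 (2 * n) * wheelFac K₀ ω 1 (2 * n + 3)) ^ 2) * hc'

/-- The reversed exponent as "erase plus single". [folklore] -/
theorem revExp_eq_erase_add_single (j D : ℕ) (e : ℕ →₀ ℕ) : revExp j D e = e.erase j + Finsupp.single j (D - e j) := by
  ext i
  by_cases hi : i = j
  · subst hi; rw [revExp_apply_self, Finsupp.add_apply, Finsupp.erase_same, Finsupp.single_eq_same, zero_add]
  · rw [revExp_apply_of_ne _ hi, Finsupp.add_apply, Finsupp.erase_ne hi, Finsupp.single_apply, if_neg (Ne.symm hi), add_zero]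

/-- The reversed exponent of `t + v·δ_j` with `t_j = 0`. [folklore] -/
theorem revExp_add_single_self {j D : ℕ} {t : ℕ →₀ ℕ} (ht : t j = 0) (v : ℕ) :
    revExp j D (t + Finsupp.single j v) = t + Finsupp.single j (D - v) := by
  ext i
  by_cases hi : i = j
  · subst hi
    rw [revExp_apply_self, Finsupp.add_apply, Finsupp.add_apply, ht, Finsupp.single_eq_same, Finsupp.single_eq_same,
      zero_add, zero_add]
  · rw [revExp_apply_of_ne _ hi, Finsupp.add_apply, Finsupp.add_apply, Finsupp.single_apply, Finsupp.single_apply,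
      if_neg (Ne.symm hi), if_neg (Ne.symm hi)]

/-- A renaming with `f⁻¹(j) = {j}` does not create `j`-exponents from a `j`-free exponent. [folklore] -/
theorem mapDomain_erase_apply_self {f : ℕ → ℕ} {j : ℕ} (hf : ∀ i, f i = j → i = j) (e : ℕ →₀ ℕ) :
    Finsupp.mapDomain f (e.erase j) j = 0 := by
  classical
  rw [Finsupp.mapDomain, Finsupp.sum_apply, Finsupp.sum]
  refine Finset.sum_eq_zero fun a ha => ?_
  rw [Finsupp.single_apply, if_neg]
  intro h
  have := hf a h; subst this
  rw [Finsupp.mem_support_iff, Finsupp.erase_same] at ha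
  exact ha rfl

/-- The reversed exponent commutes with such a renaming fixing `j`. [folklore] -/
theorem mapDomain_revExp {f : ℕ → ℕ} {j : ℕ} (hfj : f j = j) (hf : ∀ i, f i = j → i = j) (D : ℕ) (e : ℕ →₀ ℕ) :
    Finsupp.mapDomain f (revExp j D e) = revExp j D (Finsupp.mapDomain f e) := by
  have he : e = e.erase j + Finsupp.single j (e j) := (Finsupp.erase_add_single j e).symm
  rw [revExp_eq_erase_add_single, Finsupp.mapDomain_add, Finsupp.mapDomain_single, hfj]
  conv_rhs => rw [he, Finsupp.mapDomain_add, Finsupp.mapDomain_single, hfj,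
    revExp_add_single_self (mapDomain_erase_apply_self hf e)]

/-- Reversal at `j` commutes with a renaming that fixes `j` and has `{j}` as the preimage of `j`. [folklore] -/
theorem rename_revPoly_of_fix {f : ℕ → ℕ} {j : ℕ} (hfj : f j = j) (hf : ∀ i, f i = j → i = j) (D : ℕ) (F : MvPolynomial ℕ K₀) :
    rename f (revPoly j D F) = revPoly j D (rename f F) := by
  classical
  conv_lhs => rw [F.as_sum, revPoly_finset_sum, map_sum]
  conv_rhs => rw [F.as_sum, map_sum, revPoly_finset_sum]
  refine Finset.sum_congr rfl fun e _ => ?_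
  rw [revPoly_monomial, rename_monomial, rename_monomial, revPoly_monomial, mapDomain_revExp hfj hf]

/-- A renaming with `f⁻¹(j) = {j}` does not increase the `X_j`-degree. [folklore] -/
theorem degreeOf_rename_le_of_fix {f : ℕ → ℕ} {j : ℕ} (hf : ∀ i, f i = j → i = j) (F : MvPolynomial ℕ K₀) :
    (rename f F).degreeOf j ≤ F.degreeOf j := by
  rw [rename_eq_aeval]
  refine degreeOf_aeval_le_self _ j (fun i => ?_) F
  simp only [Function.comp, degreeOf_X]
  by_cases h : i = j
  · subst h
    rw [if_pos rfl]
    split_ifs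
    · exact le_rfl
    · exact Nat.zero_le _
  · rw [if_neg h, if_neg (fun h' => h (hf i h'.symm))]
/-- The symmetric product of variables is swap-invariant. [folklore] -/
theorem rename_swap_prod_X {S : Finset ℕ} {i j : ℕ} (hi : i ∈ S) (hj : j ∈ S) :
    rename (Equiv.swap i j) (∏ k ∈ S, (X k : MvPolynomial ℕ K₀)) = ∏ k ∈ S, X k := by
  rw [map_prod]
  simp only [rename_X]
  exact Finset.prod_equiv (Equiv.swap i j) (fun k => by
    simp only [Equiv.swap_apply_def]; split_ifs <;> simp_all) (fun k _ => rfl)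

/-- `resEta` of the product of the window variables. [folklore] -/
theorem resEta_prod_X (ω : K₀) (n : ℕ) :
    resEta K₀ ω 1 (∏ k ∈ Finset.Icc 1 (2 * (n + 1)), (X k : MvPolynomial ℕ K₀)) =
      C ω * X 1 ^ 2 * ∏ k ∈ Finset.Icc 3 (2 * n + 2), X k := by
  rw [show Finset.Icc 1 (2 * (n + 1)) = insert 1 (insert 2 (Finset.Icc 3 (2 * n + 2))) by
    ext k; simp only [Finset.mem_Icc, Finset.mem_insert]; omega,
    Finset.prod_insert (by simp), Finset.prod_insert (by simp), map_mul, map_mul, resEta_X, if_neg (by norm_num),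
    resEta_X, if_pos rfl, map_prod, Finset.prod_congr rfl fun k hk => by
      rw [resEta_X, if_neg (by simp only [Finset.mem_Icc] at hk; omega)]]
  ring

/-- It is nonzero. [folklore] -/
theorem resEta_prod_X_ne_zero {ω : K₀} (hω0 : ω ≠ 0) (n : ℕ) :
    resEta K₀ ω 1 (∏ k ∈ Finset.Icc 1 (2 * (n + 1)), (X k : MvPolynomial ℕ K₀)) ≠ 0 := by
  rw [resEta_prod_X]
  exact mul_ne_zero (mul_ne_zero (by rwa [Ne, C_eq_zero]) (pow_ne_zero _ (X_ne_zero _)))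
    (Finset.prod_ne_zero_iff.2 fun k _ => X_ne_zero _)

/-- Palindromicity (field form, `D = 2`) of the product of the window variables. [folklore] -/
theorem pal_prod_X {S : Finset ℕ} {j : ℕ} (hj : j ∈ S) :
    genInv K₀ j (toRF K₀ (∏ k ∈ S, (X k : MvPolynomial ℕ K₀))) * genZ K₀ j ^ 2 = toRF K₀ (∏ k ∈ S, X k) := by
  have hz : genZ K₀ j ≠ 0 := genZ_ne_zero j
  rw [map_prod, map_prod, ← Finset.mul_prod_erase _ _ hj, ← Finset.mul_prod_erase _ _ hj]
  simp only [show ∀ k, toRF K₀ (X k) = genZ K₀ k from fun k => rfl, genInv_genZ, Function.update_self]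
  rw [Finset.prod_congr rfl fun k hk => by rw [Function.update_of_ne (Finset.ne_of_mem_erase hk)]]
  field_simp

/-- **`Ĉ_{n+1}` is symmetric under the transpositions of `{1, …, 2n+2}`.** [folklore] -/
theorem rename_swap_cHat [CharZero K₀] (n : ℕ) {i j : ℕ} (hi : 1 ≤ i) (hiL : i ≤ 2 * (n + 1)) (hj : 1 ≤ j)
    (hjL : j ≤ 2 * (n + 1)) : rename (Equiv.swap i j) (cHat K₀ (n + 1)) = cHat K₀ (n + 1) := by
  rw [cHat, map_mul, map_mul, rename_swap_prod_X (by simp; omega) (by simp; omega),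
    rename_swap_uChar 1 _ (by simp; omega) (by simp; omega),
    rename_swap_rename_dblMap (by omega) (by omega) (by omega) (by omega), rename_swap_uChar 1 _ (by simp; omega) (by simp; omega)]

/-- **`Ĉ_{n+1}` is palindromic (field form) in each `U_j`, `1 ≤ j ≤ 2n+2`, with formal degree `4(n+1)`.** [folklore] -/
theorem pal_cHat [CharZero K₀] {ω : K₀} (hω : ω ^ 2 + ω + 1 = 0) (hω1 : ω ≠ 1) (n : ℕ) {j : ℕ} (hj : 1 ≤ j)
    (hjL : j ≤ 2 * (n + 1)) :
    genInv K₀ j (toRF K₀ (cHat K₀ (n + 1))) * genZ K₀ j ^ (4 * (n + 1)) = toRF K₀ (cHat K₀ (n + 1)) := by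
  -- the three factors
  have h1 := pal_prod_X (K₀ := K₀) (S := Finset.Icc 1 (2 * (n + 1))) (j := j) (by simp; omega)
  have h2 := (uChar_isWheelPoly_even (K₀ := K₀) hω hω1 1 n).pal j hj (by omega)
  have hW := uChar_isWheelPoly_even (K₀ := K₀) hω hω1 1 (n + 1)
  have hfix : ∀ i, dblMap (2 * (n + 1) + 1) i = j → i = j := fun i h => by
    unfold dblMap at h; split_ifs at h <;> omega
  have hrev : revPoly j (2 * (n + 1)) (rename (dblMap (2 * (n + 1) + 1)) (uChar K₀ 1 (2 * (n + 1) + 2))) =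
      rename (dblMap (2 * (n + 1) + 1)) (uChar K₀ 1 (2 * (n + 1) + 2)) := by
    rw [← rename_revPoly_of_fix (dblMap_of_ne (by omega)) hfix, hW.revPoly_eq hj (by omega)]
  have hdeg3 : (rename (dblMap (2 * (n + 1) + 1)) (uChar K₀ 1 (2 * (n + 1) + 2))).degreeOf j ≤ 2 * (n + 1) :=
    (degreeOf_rename_le_of_fix hfix _).trans (hW.deg j hj (by omega))
  have h3 := genInv_mul_pow_eq_of_revPoly hdeg3 hrev
  rw [show 2 * n + 2 = 2 * (n + 1) by ring] at h2
  rw [cHat, map_mul, map_mul, map_mul, map_mul]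
  calc _ = (genInv K₀ j (toRF K₀ (∏ k ∈ Finset.Icc 1 (2 * (n + 1)), (X k : MvPolynomial ℕ K₀))) * genZ K₀ j ^ 2) *
        (genInv K₀ j (toRF K₀ (uChar K₀ 1 (2 * (n + 1)))) * genZ K₀ j ^ (2 * n)) *
        (genInv K₀ j (toRF K₀ (rename (dblMap (2 * (n + 1) + 1)) (uChar K₀ 1 (2 * (n + 1) + 2)))) *
          genZ K₀ j ^ (2 * (n + 1))) := by
          rw [show 4 * (n + 1) = 2 + 2 * n + 2 * (n + 1) by ring, pow_add, pow_add]; ring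
    _ = _ := by rw [h1, h2, h3]

/-- The product of the window variables divides `Ĉ_{n+1}`. [folklore] -/
theorem prod_X_dvd_cHat (n : ℕ) : (∏ k ∈ Finset.Icc 1 (2 * (n + 1)), (X k : MvPolynomial ℕ K₀)) ∣ cHat K₀ (n + 1) := by
  rw [cHat, mul_assoc]; exact dvd_mul_right _ _

end CharSide



/-! ### The closed form `N̂ = κ² Ĉ` (IP12 Prop. 4.5), inductive step -/

section ClosedForm

open MvPolynomial Literature.Combinatorics.Enumerative

variable {n : ℕ} {q : ℂ} {P : ColPattern (n + 1) → MvPolynomial ℕ ℂ} {a : ℤ}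

namespace IsGroundState

/-- `Ẑ = κ χ̂_L` in the `U`-world. [cite: IkhlefPonsaing2012, Prop. 3.4] -/
theorem zSumHat_eq (hq : q ^ 2 + q + 1 = 0) (h : IsGroundState (n + 1) q P a) (hb : GroundStateBounds (n + 1) P) :
    ∃ κ : ℂ, κ ≠ 0 ∧ zSumHat P = C κ * uChar ℂ 1 (2 * (n + 1) + 1) := by
  obtain ⟨-, κ, hκ, hZ⟩ := h.sumRule hq hb
  refine ⟨κ, hκ, uSq_injective (K₀ := ℂ) ?_⟩
  rw [uSq_zSumHat fun Q s hs k => h.even_exponent hq Q hs k, hZ, map_mul, uSq_C]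

/-- **`N̂|_{U_2 = ωU_1}` from the recursion, the sum rule at both widths, the character recursion and
the closed form at the smaller width.** [cite: IkhlefPonsaing2012, Props. 4.3, 4.5] -/
theorem resEta_nHat (hq : q ^ 2 + q + 1 = 0) (h : IsGroundState (n + 1) q P a) (hb : GroundStateBounds (n + 1) P)
    {P'' : ColPattern n → MvPolynomial ℕ ℂ} {a'' : ℤ} (h'' : IsGroundState n q P'' a'')
    (hdeg'' : ∀ k, 1 ≤ k → k ≤ 2 * n + 1 → ∀ R, (uHalf ℂ (P'' R)).degreeOf k ≤ 2 * n)
    {κ'' : ℂ} (hκ'' : κ'' ≠ 0) (hZ'' : zSumHat P'' = C κ'' * uChar ℂ 1 (2 * n + 1))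
    (hN'' : nHat n P'' = C (κ'' ^ 2) * cHat ℂ n) {κ : ℂ} (hZ : zSumHat P = C κ * uChar ℂ 1 (2 * (n + 1) + 1)) :
    resEta ℂ (q ^ 2) 1 (nHat (n + 1) P) =
      C (κ ^ 2 * (q ^ 2) ^ (4 * n)) * X 1 ^ 2 * wheelE ℂ (q ^ 2) 1 (2 * n + 1) ^ 2 * hatRename 1 (cHat ℂ n) := by
  have hω := omega_sq_quad hq
  have hω1 : q ^ 2 ≠ 1 := sq_ne_one_of_quad hq (by norm_num)
  have hdeg : ∀ k, 1 ≤ k → k ≤ 2 * (n + 1) + 1 → ∀ Q, (uHalf ℂ (P Q)).degreeOf k ≤ 2 * (n + 1) :=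
    fun k hk hkL Q => h.degreeOf_uHalf_le' hq hb hk hkL Q
  have R := nHat_recursion hq h h'' hdeg hdeg''
  -- the reversals do nothing
  have hrev'' : revAll ℂ (2 * n) (2 * n + 1) (zSumHat P'') = zSumHat P'' := by
    refine revAll_eq_self (fun k hk hkL => degreeOf_zSumHat_le (hdeg'' k hk hkL)) fun k hk hkL => ?_
    rw [hZ'']
    exact ((uChar_isWheelPoly_odd hω hω1 1 n).C_mul κ'').pal k hk (by omega)
  have hrev : revAll ℂ (2 * (n + 1)) (2 * (n + 1) + 1) (zSumHat P) = zSumHat P := by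
    refine revAll_eq_self (fun k hk hkL => degreeOf_zSumHat_le (hdeg k hk hkL)) fun k hk hkL => ?_
    rw [hZ]
    exact ((uChar_isWheelPoly_odd hω hω1 1 (n + 1)).C_mul κ).pal k hk (by omega)
  have hres : resEta ℂ (q ^ 2) 1 (uChar ℂ 1 (2 * (n + 1) + 1)) =
      C (-(q ^ 2) ^ (2 * n)) * uChar ℂ 3 (2 * n + 1) * (X 1 * wheelE ℂ (q ^ 2) 1 (2 * n + 1)) := by
    rw [show 2 * (n + 1) + 1 = 2 * n + 3 by ring, resEta_uChar_odd hω hω1 1 n]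
  rw [hrev'', hrev, hZ'', hN'', hZ, map_mul, hatRename_C, hatRename_uChar, map_mul, hatRename_C, map_mul,
    show resEta ℂ (q ^ 2) 1 (C κ) = C κ from AlgHom.commutes _ _, hres] at R
  -- cancel `κ''² χ̂₃²`
  have hD : (C (κ'' ^ 2) * uChar ℂ 3 (2 * n + 1) ^ 2 : MvPolynomial ℕ ℂ) ≠ 0 :=
    mul_ne_zero (by rw [Ne, C_eq_zero]; exact pow_ne_zero _ hκ'') (pow_ne_zero _ (uChar_ne_zero _ _))
  apply mul_right_cancel₀ hD
  have e1 : (C (κ'' ^ 2) : MvPolynomial ℕ ℂ) = C κ'' * C κ'' := by rw [← C_mul, sq]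
  have e2 : (C (κ ^ 2 * (q ^ 2) ^ (4 * n)) : MvPolynomial ℕ ℂ) = C κ * C κ * (C (-(q ^ 2) ^ (2 * n)) * C (-(q ^ 2) ^ (2 * n))) := by
    rw [← C_mul, ← C_mul, ← C_mul]; congr 1; ring
  rw [e1] at R ⊢
  rw [e2]
  linear_combination R

/-- **The inductive step of IP12 Prop. 4.5 in the `U`-world: `N̂ = κ² Ĉ`.** [cite: IkhlefPonsaing2012, Prop. 4.5] -/
theorem nHat_eq_of_smaller (hq : q ^ 2 + q + 1 = 0) (h : IsGroundState (n + 1) q P a) (hb : GroundStateBounds (n + 1) P)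
    {P'' : ColPattern n → MvPolynomial ℕ ℂ} {a'' : ℤ} (h'' : IsGroundState n q P'' a'')
    (hdeg'' : ∀ k, 1 ≤ k → k ≤ 2 * n + 1 → ∀ R, (uHalf ℂ (P'' R)).degreeOf k ≤ 2 * n)
    {κ'' : ℂ} (hκ'' : κ'' ≠ 0) (hZ'' : zSumHat P'' = C κ'' * uChar ℂ 1 (2 * n + 1))
    (hN'' : nHat n P'' = C (κ'' ^ 2) * cHat ℂ n) {κ : ℂ} (hZ : zSumHat P = C κ * uChar ℂ 1 (2 * (n + 1) + 1)) :
    nHat (n + 1) P = C (κ ^ 2) * cHat ℂ (n + 1) := by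
  classical
  have hq0 : q ≠ 0 := q_ne_zero_of_quad hq
  have hω := omega_sq_quad hq
  have hω1 : q ^ 2 ≠ 1 := sq_ne_one_of_quad hq (by norm_num)
  have hω3 : (q ^ 2) ^ 3 = 1 := IsWheelPoly.cube_eq_one hω
  set Pi : MvPolynomial ℕ ℂ := ∏ k ∈ Finset.Icc 1 (2 * (n + 1)), X k with hPi
  set G := nHat (n + 1) P - C (κ ^ 2) * cHat ℂ (n + 1) with hG
  -- `G` vanishes on the hyperplane
  have hresG : resEta ℂ (q ^ 2) 1 G = 0 := by
    rw [hG, map_sub, map_mul, show resEta ℂ (q ^ 2) 1 (C (κ ^ 2)) = C (κ ^ 2) from AlgHom.commutes _ _,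
      h.resEta_nHat hq hb h'' hdeg'' hκ'' hZ'' hN'' hZ, resEta_cHat_succ hω hω1]
    have : (C (κ ^ 2 * (q ^ 2) ^ (4 * n)) : MvPolynomial ℕ ℂ) = C (κ ^ 2) * C ((q ^ 2) ^ (4 * n)) := by rw [← C_mul]
    rw [this]; ring
  -- `G = Π G'`
  obtain ⟨G', hG'⟩ : Pi ∣ G := by
    rw [hG]; exact dvd_sub (h.prod_X_dvd_nHat hq hb) (dvd_mul_of_dvd_right (prod_X_dvd_cHat n) _)
  have hPi0 : Pi ≠ 0 := Finset.prod_ne_zero_iff.2 fun k _ => X_ne_zero _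
  -- symmetry of `G'`
  have hsymG : ∀ i j, 1 ≤ i → i ≤ 2 * (n + 1) → 1 ≤ j → j ≤ 2 * (n + 1) → rename (Equiv.swap i j) G = G := by
    intro i j hi hiL hj hjL
    rw [hG, map_sub, map_mul, rename_C, rename_swap_cHat n hi hiL hj hjL]
    rcases le_total i j with hij | hij
    · rw [h.rename_swap_nHat' hq hb hi hij hjL]
    · rw [Equiv.swap_comm, h.rename_swap_nHat' hq hb hj hij hiL]
  have hsymG' : ∀ i j, 1 ≤ i → i < 1 + 2 * (n + 1) → 1 ≤ j → j < 1 + 2 * (n + 1) → rename (Equiv.swap i j) G' = G' := by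
    intro i j hi hiL hj hjL
    have h1 := hsymG i j hi (by omega) hj (by omega)
    rw [hG', map_mul, hPi, rename_swap_prod_X (by simp; omega) (by simp; omega)] at h1
    exact mul_left_cancel₀ hPi0 h1
  -- palindromicity of `G'` with formal degree `4n + 2`
  have hpalG : ∀ j, 1 ≤ j → j ≤ 2 * (n + 1) → genInv ℂ j (toRF ℂ G) * genZ ℂ j ^ (4 * (n + 1)) = toRF ℂ G := by
    intro j hj hjL
    rw [hG, map_sub, map_sub, sub_mul, h.pal_nHat hq hb hj (by omega), map_mul, map_mul,
      show toRF ℂ (C (κ ^ 2)) = genC ℂ (κ ^ 2) from rfl, genInv_genC, mul_assoc, pal_cHat hω hω1 n hj hjL]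
  have hpalG' : ∀ j, 1 ≤ j → j < 1 + 2 * (n + 1) → genInv ℂ j (toRF ℂ G') * genZ ℂ j ^ (4 * n + 2) = toRF ℂ G' := by
    intro j hj hjL
    have h1 := hpalG j hj (by omega)
    have hP := pal_prod_X (K₀ := ℂ) (S := Finset.Icc 1 (2 * (n + 1))) (j := j) (by simp; omega)
    rw [hG', map_mul, map_mul] at h1
    have hPi' : toRF ℂ Pi ≠ 0 := fun h0 => hPi0 (toRF_injective (h0.trans (map_zero _).symm))
    apply mul_left_cancel₀ hPi'
    calc toRF ℂ Pi * (genInv ℂ j (toRF ℂ G') * genZ ℂ j ^ (4 * n + 2))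
        = (genInv ℂ j (toRF ℂ Pi) * genZ ℂ j ^ 2) * (genInv ℂ j (toRF ℂ G') * genZ ℂ j ^ (4 * n + 2)) := by rw [hP]
      _ = genInv ℂ j (toRF ℂ Pi) * genInv ℂ j (toRF ℂ G') * genZ ℂ j ^ (4 * (n + 1)) := by
          rw [show 4 * (n + 1) = 2 + (4 * n + 2) by ring, pow_add]; ring
      _ = toRF ℂ Pi * toRF ℂ G' := h1
  -- degrees of `G'`
  have hdegG' : ∀ j, 1 ≤ j → j < 1 + 2 * (n + 1) → G'.degreeOf j ≤ 4 * n + 2 := fun j hj hjL =>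
    degreeOf_le_of_genInv_mul_pow (hpalG' j hj hjL)
  -- restriction of `G'`
  have hresG' : substHom (1 + 1) (C (q ^ 2) * X 1) G' = 0 := by
    have h1 := hresG
    rw [hG', map_mul] at h1
    rcases mul_eq_zero.1 h1 with h0 | h0
    · exact absurd h0 (resEta_prod_X_ne_zero (pow_ne_zero _ hq0) n)
    · exact h0
  have hG'0 : G' = 0 :=
    eq_zero_of_res_eq_zero' (u := 1) (L := 2 * (n + 1)) (D := 4 * n + 2) hω hω1 hsymG' hdegG' hpalG' (by omega) (by omega) hresG'
  have hG0 : G = 0 := by rw [hG', hG'0, mul_zero]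
  rw [hG] at hG0
  exact sub_eq_zero.1 hG0

end IsGroundState

end ClosedForm

/-! ### The width-`0` system and the induction -/

section BaseAndInduction

open MvPolynomial Literature.Combinatorics.Enumerative

/-- The unique valid pattern at width `0`. [folklore] -/
def cpZero : ColPattern 0 := (fun _ _ => true, fun _ => true)

/-- A valid pattern at width `0` is `cpZero`. [folklore] -/
theorem eq_cpZero_of_isValid {R : ColPattern 0} (h : IsValid 0 R) : R = cpZero := by
  refine Prod.ext (funext fun i => funext fun j => ?_) (funext fun i => ?_)
  · have hi : i = 0 := Fin.ext (by omega)
    have hj : j = 0 := Fin.ext (by omega)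
    subst hi; subst hj
    exact h.refl 0
  · have hi : i = 0 := Fin.ext (by omega)
    subst hi
    exact h.bottom (by norm_num)

/-- The junction at width `0` holds for `cpZero`. [folklore] -/
theorem ipJunction_cpZero : ipJunction 0 (Fin.last 0) cpZero cpZero = true := by
  classical
  simp only [ipJunction, decide_eq_true_eq]
  exact ⟨0, Relation.EqvGen.refl _, Or.inl rfl⟩

/-- `uHalf` of a constant. [folklore] -/
theorem uHalf_C (c : ℂ) : uHalf ℂ (C c) = C c := by
  classical
  apply uSq_injective (K₀ := ℂ)
  rw [uSq_uHalf (fun s hs k => ?_), uSq_C]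
  rw [mem_support_iff, coeff_C] at hs
  split_ifs at hs with h0
  · subst h0; simp
  · exact absurd rfl hs

/-- `uHalf 0 = 0`. [folklore] -/
theorem uHalf_zero : uHalf ℂ (0 : MvPolynomial ℕ ℂ) = 0 := by
  rw [← C_0, uHalf_C]

variable {q : ℂ}

/-- **The width-`0` ground state is a nonzero constant on `cpZero`** (and `0` elsewhere).
[cite: IkhlefPonsaing2012, §3.4] -/
theorem IsGroundState.width_zero (hq : q ^ 2 + q + 1 = 0) {P : ColPattern 0 → MvPolynomial ℕ ℂ} {a : ℤ}
    (h : IsGroundState 0 q P a) : ∃ c : ℂ, c ≠ 0 ∧ P cpZero = C c ∧ ∀ R, R ≠ cpZero → P R = 0 := by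
  have hoff : ∀ R, R ≠ cpZero → P R = 0 := fun R hR => by
    by_contra hne
    exact hR (eq_cpZero_of_isValid (h.supp hq R fun h0 => hne (toRF_injective (h0.trans (map_zero _).symm))).1)
  have hunit : IsUnit (P cpZero) := h.prim (P cpZero) fun R => by
    by_cases hR : R = cpZero
    · subst hR; exact dvd_rfl
    · rw [hoff R hR]; exact dvd_zero _
  obtain ⟨c, hc, hPc⟩ := MvPolynomial.isUnit_iff_eq_C_of_isReduced.1 hunit
  exact ⟨c, hc.ne_zero, hPc, hoff⟩

/-- **The closed form at width `0`.** [folklore] -/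
theorem IsGroundState.closedForm_zero (hq : q ^ 2 + q + 1 = 0) {P : ColPattern 0 → MvPolynomial ℕ ℂ} {a : ℤ}
    (h : IsGroundState 0 q P a) :
    (∀ k, 1 ≤ k → k ≤ 2 * 0 + 1 → ∀ R, (uHalf ℂ (P R)).degreeOf k ≤ 2 * 0) ∧
      ∃ κ : ℂ, κ ≠ 0 ∧ zSumHat P = C κ * uChar ℂ 1 (2 * 0 + 1) ∧ nHat 0 P = C (κ ^ 2) * cHat ℂ 0 := by
  classical
  obtain ⟨c, hc, hP0, hoff⟩ := h.width_zero hq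
  have hhalf : ∀ R, uHalf ℂ (P R) = if R = cpZero then C c else 0 := fun R => by
    split_ifs with hR
    · rw [hR, hP0, uHalf_C]
    · rw [hoff R hR, uHalf_zero]
  refine ⟨fun k _ _ R => ?_, c, hc, ?_, ?_⟩
  · rw [hhalf]; split_ifs
    · rw [degreeOf_C]
    · rw [degreeOf_zero]
  · rw [zSumHat, Finset.sum_eq_single cpZero (fun R _ hR => by rw [hhalf, if_neg hR]) (fun h0 => absurd (Finset.mem_univ _) h0),
      hhalf, if_pos rfl, uChar_of_le_two 1 (by norm_num), mul_one]
  · rw [nHat, Finset.sum_eq_single cpZero (fun R _ hR => Finset.sum_eq_zero fun R' _ => by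
        rw [hhalf R, if_neg hR, revAll_zero, zero_mul, zero_mul]) (fun h0 => absurd (Finset.mem_univ _) h0),
      Finset.sum_eq_single cpZero (fun R' _ hR' => by rw [hhalf R', if_neg hR', mul_zero, zero_mul])
        (fun h0 => absurd (Finset.mem_univ _) h0),
      hhalf, if_pos rfl, ipJunction_cpZero, if_pos rfl, mul_one, cHat, show 2 * 0 = 0 from rfl,
      Finset.Icc_eq_empty (by norm_num), Finset.prod_empty, uChar_of_le_two 1 (by norm_num),
      uChar_of_le_two 1 (by norm_num), map_one, mul_one, mul_one, mul_one,
      revAll_eq_self (fun k _ _ => by rw [degreeOf_C]) (fun k _ _ => by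
        rw [show toRF ℂ (C c) = genC ℂ c from rfl, genInv_genC, pow_zero, mul_one]), ← C_mul, sq]

/-- **IP12 Prop. 4.5 in the cluster language, `U`-form: `N̂ = κ² Ĉ` at every width**, together with
`Ẑ = κ χ̂_L` and the window degree bound, for the primitive exact ground state, given the external
bounds (`GroundStateBounds`) at every width `1 ≤ k ≤ n`. By induction on the width through the
recursion on `H_1`. [cite: IkhlefPonsaing2012, Prop. 4.5] -/
theorem IsGroundState.closedForm (hq : q ^ 2 + q + 1 = 0) :
    ∀ (n : ℕ) (P : ColPattern n → MvPolynomial ℕ ℂ) (a : ℤ), IsGroundState n q P a →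
      (∀ (k : ℕ) (P' : ColPattern (k + 1) → MvPolynomial ℕ ℂ) (a' : ℤ), k + 1 ≤ n →
        IsGroundState (k + 1) q P' a' → GroundStateBounds (k + 1) P') →
      (∀ k, 1 ≤ k → k ≤ 2 * n + 1 → ∀ R, (uHalf ℂ (P R)).degreeOf k ≤ 2 * n) ∧
        ∃ κ : ℂ, κ ≠ 0 ∧ zSumHat P = C κ * uChar ℂ 1 (2 * n + 1) ∧ nHat n P = C (κ ^ 2) * cHat ℂ n
  | 0, P, a, h, _ => h.closedForm_zero hq
  | n + 1, P, a, h, hB => by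
    have hb : GroundStateBounds (n + 1) P := hB n P a le_rfl h
    obtain ⟨P'', a'', h''⟩ := exists_isGroundState hq n
    obtain ⟨hdeg'', κ'', hκ'', hZ'', hN''⟩ :=
      IsGroundState.closedForm hq n P'' a'' h'' fun k P' a' hk h' => hB k P' a' (by omega) h'
    obtain ⟨κ, hκ, hZ⟩ := h.zSumHat_eq hq hb
    exact ⟨fun k hk hkL Q => h.degreeOf_uHalf_le' hq hb hk hkL Q, κ, hκ, hZ,
      h.nHat_eq_of_smaller hq hb h'' hdeg'' hκ'' hZ'' hN'' hZ⟩

end BaseAndInduction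

end Literature.Probability.Percolation
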